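import Literature.Analysis.FunctionSpaces.BMO
import HarnessLib

/-!
# Discharged facts: `L^∞ ⊂ BMO` (`BMO`, bounded functions)

`Literature.Analysis.FunctionSpaces.BMO` records the basic properties of the BMO seminorm
`Literature.eBMOSeminorm f μ = sup_{x, r > 0} ⨍⁻_{B(x,r)} ‖f - f_{B(x,r)}‖ₑ dμ` as named facts
(`def … : Prop`, D-0014). This companion file (kept separate from `BMOProofs.lean`, which
carries the additivity discharges) proves

* `Literature.Analysis.FunctionSpaces.laverage_enorm_sub_average_le_two_mul_eLpNorm_top` — the one-measure estimate
  `⨍⁻ ‖f - ⨍ f dν‖ₑ dν ≤ 2 ‖f‖_{L^∞(ν)}` behind everything below;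
* `Literature.Analysis.FunctionSpaces.eBMOSeminorm_le_two_mul_eLpNorm_top_holds` — `‖f‖_* ≤ 2 ‖f‖_∞` (Stein, *Harmonic
  Analysis* (1993), IV.1.1.1: `L^∞ ⊂ BMO`; Grafakos, *Modern Fourier Analysis*, 3rd ed.,
  Proposition 3.1.2 (2), with the printed one-line proof
  `Avg_Q |f - Avg_Q f| ≤ 2 Avg_Q |f| ≤ 2 ‖f‖_{L^∞}`, followed here ball by ball);
* `Literature.Analysis.FunctionSpaces.memBMO_of_bounded_holds`, `Literature.Analysis.FunctionSpaces.memBMO_of_memLp_top_holds` — `L^∞ ⊂ BMO` for locally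
  finite `μ` (the interim proofs preserved as comments in `BMO.lean`, now fed by
  `eBMOSeminorm_le_two_mul_eLpNorm_top_holds`),

so that users holding `(h : eBMOSeminorm_le_two_mul_eLpNorm_top)` etc. can discharge the
hypothesis with the corresponding `_holds` theorem.

## Design notes

* No completeness, finiteness or integrability hypothesis is needed for the seminorm bound: for a
  ball `B` the quantity `⨍⁻_B ‖f - f_B‖ₑ dμ` is a `lintegral` against the normalised measure
  `ν' = (μ B)⁻¹ • μ|_B`, whose total mass is `(μ B)⁻¹ μ B ≤ 1` in *all* cases (`= 0` when
  `μ B ∈ {0, ∞}`), and the Bochner average `f_B = ∫ f dν'` satisfies `‖f_B‖ₑ ≤ ∫⁻ ‖f‖ₑ dν' ≤ ‖f‖_∞`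
  whether or not it is a junk `0`. Hence `‖f(y) - f_B‖ₑ ≤ 2 ‖f‖_{L^∞(μ)}` for `ν'`-a.e. `y`
  (`ν' ≪ μ`), and integrating against `ν'` gives the claim.

## References

* E. M. Stein, *Harmonic Analysis: Real-Variable Methods, Orthogonality, and Oscillatory
  Integrals*, Princeton Math. Ser. 43 (1993), Chapter IV, §1.1.1.
* L. Grafakos, *Modern Fourier Analysis*, 3rd ed., GTM 250, Springer (2014), Proposition 3.1.2.
-/

noncomputable section

open MeasureTheory Metric Filter Topology
open scoped ENNReal NNReal

namespace Literature.Analysis.FunctionSpaces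

section BMOBoundedProofs

variable {X : Type*} [PseudoMetricSpace X] [MeasurableSpace X]
variable {F : Type*} [NormedAddCommGroup F] [NormedSpace ℝ F]

/-- The mean oscillation of `f` with respect to a single measure `ν` is at most `2 ‖f‖_{L^∞(ν)}`:
`⨍⁻ ‖f - ⨍ f dν‖ₑ dν ≤ 2 ‖f‖_∞`, by `‖f(y) - ⨍ f‖ ≤ ‖f(y)‖ + ⨍ ‖f‖ ≤ 2 ‖f‖_∞` for `ν`-a.e. `y`
(Grafakos, *Modern Fourier Analysis*, 3rd ed., proof of Proposition 3.1.2 (2):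
`Avg_Q |f - Avg_Q f| ≤ 2 Avg_Q |f| ≤ 2 ‖f‖_{L^∞}`; Stein IV.1.1.1). No completeness, finiteness or
integrability hypothesis is needed: in the degenerate cases (`ν univ ∈ {0, ∞}`, `f ∉ L¹(ν)`, `F` not
complete) the normalised measure `(ν univ)⁻¹ • ν` has total mass `≤ 1` and the Bochner average is
`0` or a genuine average, so the same estimate holds. [cite: GrafakosMFA2014, Proposition 3.1.2 (2)] -/
theorem laverage_enorm_sub_average_le_two_mul_eLpNorm_top {Y : Type*} [MeasurableSpace Y]
    (f : Y → F) (ν : Measure Y) :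
    ⨍⁻ y, ‖f y - ⨍ z, f z ∂ν‖ₑ ∂ν ≤ 2 * eLpNorm f ∞ ν := by
  set C := eLpNorm f ∞ ν
  set ν' : Measure Y := (ν Set.univ)⁻¹ • ν
  have hν'1 : ν' Set.univ ≤ 1 := by
    simp only [ν', Measure.smul_apply, smul_eq_mul]
    exact ENNReal.inv_mul_le_one _
  have hae : ∀ᵐ y ∂ν', ‖f y‖ₑ ≤ C := by
    have h := enorm_ae_le_eLpNormEssSup f ν
    rw [← eLpNorm_exponent_top] at h
    exact Measure.ae_smul_measure h _
  have havg : ‖⨍ z, f z ∂ν‖ₑ ≤ C := by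
    rw [average_eq']
    calc ‖∫ z, f z ∂ν'‖ₑ ≤ ∫⁻ z, ‖f z‖ₑ ∂ν' := enorm_integral_le_lintegral_enorm _
      _ ≤ ∫⁻ _, C ∂ν' := lintegral_mono_ae hae
      _ = C * ν' Set.univ := lintegral_const C
      _ ≤ C * 1 := by gcongr
      _ = C := mul_one C
  rw [laverage_eq']
  calc ∫⁻ y, ‖f y - ⨍ z, f z ∂ν‖ₑ ∂ν' ≤ ∫⁻ _, (C + C) ∂ν' :=
        lintegral_mono_ae (hae.mono fun y hy => enorm_sub_le.trans (add_le_add hy havg))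
    _ = (C + C) * ν' Set.univ := lintegral_const _
    _ ≤ (C + C) * 1 := by gcongr
    _ = 2 * C := by rw [mul_one, two_mul]

/-- **`L^∞ ⊂ BMO`, `‖f‖_* ≤ 2 ‖f‖_∞`**: discharge of the named fact
`eBMOSeminorm_le_two_mul_eLpNorm_top` (Stein, *Harmonic Analysis* IV.1.1.1; Grafakos, *Modern
Fourier Analysis*, 3rd ed., Proposition 3.1.2 (2), whose one-line proof
`Avg_B |f - Avg_B f| ≤ 2 Avg_B |f| ≤ 2 ‖f‖_{L^∞}` is followed ball by ball via
`laverage_enorm_sub_average_le_two_mul_eLpNorm_top` applied to `μ|_{B(x,r)}` and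
`‖f‖_{L^∞(μ|_B)} ≤ ‖f‖_{L^∞(μ)}`). [cite: SteinHA1993, IV.1.1.1 (L^∞ ⊂ BMO)] -/
theorem eBMOSeminorm_le_two_mul_eLpNorm_top_holds :
    eBMOSeminorm_le_two_mul_eLpNorm_top (X := X) (F := F) := by
  intro f μ
  refine iSup_le fun x => iSup₂_le fun r _ => ?_
  calc ⨍⁻ y in ball x r, ‖f y - ⨍ z in ball x r, f z ∂μ‖ₑ ∂μ
      ≤ 2 * eLpNorm f ∞ (μ.restrict (ball x r)) :=
        laverage_enorm_sub_average_le_two_mul_eLpNorm_top f _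
    _ ≤ 2 * eLpNorm f ∞ μ := by gcongr; exact Measure.restrict_le_self

/-- **`L^∞ ⊂ BMO`** for a locally finite measure (Stein, *Harmonic Analysis* IV.1.1.1): discharge
of the named fact `memBMO_of_bounded` — an `L^∞` function is locally integrable
(`MeasureTheory.MemLp.locallyIntegrable`) and `‖f‖_* ≤ 2 ‖f‖_∞ < ∞`
(`eBMOSeminorm_le_two_mul_eLpNorm_top_holds`). This is the interim proof preserved as a comment
in `BMO.lean`. [cite: SteinHA1993, IV.1.1.1 (L^∞ ⊂ BMO)] -/
theorem memBMO_of_bounded_holds : memBMO_of_bounded (X := X) (F := F) := by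
  intro f μ _ hf
  exact ⟨hf.locallyIntegrable le_top, (eBMOSeminorm_le_two_mul_eLpNorm_top_holds f μ).trans_lt
    (ENNReal.mul_lt_top (by simp) hf.eLpNorm_lt_top)⟩

/-- **`L^∞ ⊂ BMO`** (Stein, *Harmonic Analysis* IV.1.1.1), Mathlib-style name: discharge of the
named fact `memBMO_of_memLp_top`, identical to `memBMO_of_bounded_holds`. [cite: SteinHA1993, IV.1.1.1 (L^∞ ⊂ BMO)] -/
theorem memBMO_of_memLp_top_holds : memBMO_of_memLp_top (X := X) (F := F) :=
  fun hf => memBMO_of_bounded_holds hf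

end BMOBoundedProofs

end Literature.Analysis.FunctionSpaces
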